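import Summits.CriticalPhenomena.PercolationContinuityZ3.Theorems.PercNearOneGluingNoHeavyQuantLawDecFlows
import HarnessLib

/-!
# QUANT lane R8, T-DEC: the MONGE PROPERTY of the DEC usage rates — `LawDec.usage` is log-supermodular on compatible
# quadruples and antitone in both atoms (the uncrossing inequality behind a canonical, cornered optimal flow for DEC(j′))

builds on p205010 (kernel theorem, internal audit signed; external expert review pending)

Support file (`--supports stmt-CriticalPhenomena-4575`), QUANT lane lead seat (gen 21), rung R8 of
`run/shared/lean/prim/quant/LADDER.md`; memo `run/shared/lean/prim/quant/prim-quant-lead-g21/LEAD-NOTES-G21.md` N45.  Theorems only,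
standard axioms, no sorries.  Continues the typer's flow normal form of DEC(j′) (`…QuantLawDecFlows`: `LawDec.pairGate`, `LawDec.gateOf`,
`LawDec.usage`, `LawDec.FlowAtT`; `…QuantLawDecFlowsDecomposition`: `decAt_iff_flowAt`).

THE FINDING (lead g21, exact LP with prim-quant-census-2's engines).  In the flow form of DEC(j′) — low atoms `l` (`l ≤ j′`, `2l < T`)
shipped to giants (`h ≥ j′+1`, rate `x/(1−x)`) and to compatible mids (`h ≤ j′`, `2h ≥ T`, `l + h > T`) at the rate
`usage(l,h) = γ/(1−γ)`, `γ = max(ρ, x² + (1−x)ρ)`, `ρ = (T−2l)/(h−l)` — the census's GREEDY-DEC rule ("cheapest credit pair first") is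
NOT optimal on general laws (it under-serves the mid sub-problem in 13–27 % of sampled (law, layer) pairs), but the SOUTH-WEST CORNER RULE
(lows in DECREASING order, each shipped to compatible mids in INCREASING order, leftovers to the giants) attains the exact LP optimum in every
instance tested (≈ 8 500 exact (law, target, layer) triples locally, kit j135057 at scale).  The reason is the classical one (Hoffman 1963:
corner rules are optimal for Monge arrays): the usage rates form a (multiplicative) MONGE ARRAY on the staircase of compatible pairs, which is
what this file proves.

THE MATHEMATICS.  For a low `l` and a compatible mid `h` write `p = T − 2l > 0` (deficit), `d = h − l`, `s = l + h − T = d − p > 0`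
(slack), `ρ = p/d ∈ (0,1)`.  Then `usage = max(u_H, u_L)` with the HEAVY metric `u_H = ρ/(1−ρ) = (T−2l)/(l+h−T)` and the LIGHT metric
`u_L = λ/(1−λ)`, `λ = x² + (1−x)ρ`, in closed form `u_L = (x²(h−l) + (1−x)(T−2l))/((1−x)((1−x)l + (1+x)h − T))` — both ratios of
AFFINE functions of `(l, h)` with the right signs.  For lows `l₁ < l₂` and mids `h₁ < h₂` with `T < l₁ + h₁` (all four pairs compatible):
* heavy Monge `u_H(l₂,h₁)·u_H(l₁,h₂) ≤ u_H(l₁,h₁)·u_H(l₂,h₂)` ⟺ `s₁₁s₂₂ ≤ s₁₂s₂₁` ⟺ `0 ≤ (l₂−l₁)(h₂−h₁)`;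
* light Monge: numerator `N = (1−x)T + x²h − (x²−2x+2)l` has `N₁₁N₂₂ − N₁₂N₂₁ = x²(x²−2x+2)(l₂−l₁)(h₂−h₁) ≥ 0`, denominator
  `E = (1−x)((1−x)l + (1+x)h − T)` has `E₁₂E₂₁ − E₁₁E₂₂ = (1−x)³(1+x)(l₂−l₁)(h₂−h₁) ≥ 0`;
* cross terms via `u_H/u_L = Φ(ρ)` INCREASING in `ρ`: with `f(r) = r(1+x−r)`, `g(r) = (1−r)(x²+(1−x)r)`,
  `f(r')g(r) − f(r)g(r') = (r'−r)·x·(rr'(1−x) + x(1−r)(1−r') + x²) ≥ 0` for `r ≤ r'`; and `ρ` is antitone in `l` (for `2h ≥ T`) and in `h`;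
  chaining with the heavy Monge inequality gives `u_H(l₂,h₁)u_L(l₁,h₂) ≤ u_H(l₁,h₁)u_L(l₂,h₂)` and `u_L(l₂,h₁)u_H(l₁,h₂) ≤ u_H(l₁,h₁)u_L(l₂,h₂)`;
* hence `max·max ≤ max·max`: **`usage(l₂,h₁)·usage(l₁,h₂) ≤ usage(l₁,h₁)·usage(l₂,h₂)`**; with a giant `h₂` (rate `x/(1−x)` for every low)
  the inequality reduces to antitonicity in `l`, with two giants to an equality.

* `LawDec.max_div_one_sub` — `t ↦ t/(1−t)` below `1`; `LawDec.heavy_of_rho`, `LawDec.light_of_rho` — the two metrics as functions of `ρ`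
  versus their closed forms.
* `LawDec.usage_mid_eq` — closed form `usage = max(u_H, u_L)` for a low `l` and a compatible mid `h ≤ j′`; `LawDec.usage_giant_eq`.
* `LawDec.phi_mono` — `Φ` is increasing, in the form `u_H(r)·u_L(r') ≤ u_H(r')·u_L(r)` for `0 ≤ r ≤ r' < 1`.
* `LawDec.heavy_monge`, `LawDec.light_monge`, `LawDec.heavy_light_monge`, `LawDec.light_heavy_monge` — the four closed-form inequalities.
* Part 2 (`…QuantLawDecUsageMongeRates`, proposes when this file's olean is on the farm): **`LawDec.usage_anti_low`**,
  **`LawDec.usage_anti_mid`**, **`LawDec.usage_monge`** — the same statements for `LawDec.usage` itself (giant/mid case split).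
USE (memo N45): any two crossing flow paths `l₁ → h₂`, `l₂ → h₁` of a `LawDec.FlowAtT` datum can be UNCROSSED into `l₁ → h₁`, `l₂ → h₂`
without shipping less or loading more (the standard exchange), so DEC(j′) admits a CORNERED optimal flow; this is the normal form in which a proof
of Conjecture SL (`LawDec.SliceClosed`) / `LawDec.SDECConvClosed` can compare the slice's flow with the two flows of `μ″` atom by atom.

NOVELTY / PRIOR ART.  Monge arrays and the optimality of corner (north-west / south-west) rules for transportation problems are classical
(Hoffman 1963; surveyed in Burkard–Klinz–Rudolf 1996, "Perspectives of Monge properties in optimization"); searched 2026-08-21 (corpus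
`lit search --hybrid "Monge property transportation greedy"`, galaxy "Monge|north-west corner"): the generalized-flow (gains) variant used here
is folklore-level (exchange argument); nothing in print concerns the DEC usage rates, which are this lane's.  BARRIERS: none of
`Literature/Barriers/CriticalPhenomena/…` concern finite transportation inequalities.
[this work]; DEC rules ARCH-TREES-G49 §2.2 / DEC-TAMP-G50 §3.1, flow form `…QuantLawDecFlows` (this lane).  The gluing rows served
[cite: KozmaNitzan2024, Conjecture 3 (p. 15)]; product measure [cite: Grimmett1999, §1.3 p. 10].
-/

noncomputable section

namespace Summit.CriticalPhenomena.PercolationContinuityZ3.Theorems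

namespace Quant

namespace LawDec

/-! ### `t ↦ t/(1−t)` below `1`, and the two metrics as functions of `ρ` -/

/-- `max a b/(1 − max a b) = max (a/(1−a)) (b/(1−b))` for `a, b < 1` (`t ↦ t/(1−t)` is monotone below `1`; cf.
`Literature.Analysis.InverseSpectral.KreinString.div_one_sub_mono`, not imported here to keep the import cone small). [folklore] -/
theorem max_div_one_sub {a b : ℝ} (ha : a < 1) (hb : b < 1) :
    max a b / (1 - max a b) = max (a / (1 - a)) (b / (1 - b)) := by
  have mono : ∀ {c d : ℝ}, c ≤ d → d < 1 → c / (1 - c) ≤ d / (1 - d) := by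
    intro c d hcd hd
    have hc : 0 < 1 - c := by linarith
    have hd' : 0 < 1 - d := by linarith
    rw [div_le_div_iff₀ hc hd']
    nlinarith
  rcases le_total a b with hab | hba
  · rw [max_eq_right hab, max_eq_right (mono hab hb)]
  · rw [max_eq_left hba, max_eq_left (mono hba ha)]

/-- **heavy metric**: `ρ/(1−ρ) = (T − 2l)/(l + h − T)` for `ρ = (T−2l)/(h−l)`, `h > l` (both sides are `0` by convention when
`l + h = T`). [this work] -/
theorem heavy_of_rho (T l h : ℝ) (hd : 0 < h - l) :
    (T - 2 * l) / (h - l) / (1 - (T - 2 * l) / (h - l)) = (T - 2 * l) / (l + h - T) := by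
  have h1 : (1 : ℝ) - (T - 2 * l) / (h - l) = (l + h - T) / (h - l) := by
    field_simp
    ring
  rw [h1, div_div_div_cancel_right₀ hd.ne']

/-- **light metric**: `λ/(1−λ) = (x²(h−l) + (1−x)(T−2l))/((1−x)((1−x)l + (1+x)h − T))` for `λ = x² + (1−x)ρ`,
`ρ = (T−2l)/(h−l)`, `h > l`, `l + h > T`, `x < 1`. [this work] -/
theorem light_of_rho (x T l h : ℝ) (hd : 0 < h - l) :
    (x ^ 2 + (1 - x) * ((T - 2 * l) / (h - l))) / (1 - (x ^ 2 + (1 - x) * ((T - 2 * l) / (h - l))))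
      = (x ^ 2 * (h - l) + (1 - x) * (T - 2 * l)) / ((1 - x) * ((1 - x) * l + (1 + x) * h - T)) := by
  have n1 : x ^ 2 + (1 - x) * ((T - 2 * l) / (h - l)) = (x ^ 2 * (h - l) + (1 - x) * (T - 2 * l)) / (h - l) := by
    field_simp
  have d1 : (1 : ℝ) - (x ^ 2 + (1 - x) * ((T - 2 * l) / (h - l)))
      = ((1 - x) * ((1 - x) * l + (1 + x) * h - T)) / (h - l) := by
    field_simp
    ring
  rw [d1, n1, div_div_div_cancel_right₀ hd.ne']

/-! ### Closed forms of the usage rate -/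

/-- **usage of a giant**: `h ≥ j′+1` ⟹ `usage = x/(1−x)`. [this work] -/
theorem usage_giant_eq (x T : ℝ) (j' l h : ℕ) (hh : j' + 1 ≤ h) : usage x T j' l h = x / (1 - x) := by
  simp only [usage, gateOf, if_pos hh]

/-- **usage of a compatible mid, closed form**: for a low `l` (`2l < T`), a mid `h ≤ j′` with `T < l + h`, and `0 < x < 1`,
`usage(l,h) = max(u_H, u_L)` with `u_H = (T−2l)/(l+h−T)` and `u_L = (x²(h−l) + (1−x)(T−2l))/((1−x)((1−x)l + (1+x)h − T))`. [this work] -/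
theorem usage_mid_eq (x T : ℝ) (j' l h : ℕ) (hx0 : 0 < x) (hx1 : x < 1) (hhj : h ≤ j') (hlow : 2 * (l : ℝ) < T)
    (hcomp : T < (l : ℝ) + h) :
    usage x T j' l h =
      max ((T - 2 * (l : ℝ)) / ((l : ℝ) + h - T))
        ((x ^ 2 * ((h : ℝ) - l) + (1 - x) * (T - 2 * (l : ℝ))) / ((1 - x) * ((1 - x) * (l : ℝ) + (1 + x) * h - T))) := by
  have hnj : ¬ (j' + 1 ≤ h) := by omega
  have hd : (0 : ℝ) < (h : ℝ) - l := by linarith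
  have h1x : 0 < 1 - x := by linarith
  have hρ1 : (T - 2 * (l : ℝ)) / ((h : ℝ) - l) < 1 := by rw [div_lt_one hd]; linarith
  have hlam1 : x ^ 2 + (1 - x) * ((T - 2 * (l : ℝ)) / ((h : ℝ) - l)) < 1 := by
    nlinarith [mul_lt_mul_of_pos_left hρ1 h1x, mul_pos hx0 h1x]
  simp only [usage, gateOf, if_neg hnj, pairGate]
  rw [max_div_one_sub hρ1 hlam1, heavy_of_rho T (l : ℝ) h hd, light_of_rho x T (l : ℝ) h hd]

/-! ### The scalar inequality behind the cross terms: `Φ = u_H/u_L` is increasing in `ρ` -/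

/-- **`Φ(ρ) = u_H/u_L` is increasing**, in product form: for `0 ≤ r ≤ r' < 1` and `0 < x < 1`,
`u_H(r)·u_L(r') ≤ u_H(r')·u_L(r)`, where `u_H(r) = r/(1−r)`, `u_L(r) = λ(r)/(1−λ(r))`, `λ(r) = x² + (1−x)r`.  After clearing the
(positive) denominators the difference is `(1−x)·(r'−r)·x·(rr'(1−x) + x(1−r)(1−r') + x²) ≥ 0`. [this work] -/
theorem phi_mono (x r r' : ℝ) (hx0 : 0 < x) (hx1 : x < 1) (hr0 : 0 ≤ r) (hrr : r ≤ r') (hr1 : r' < 1) :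
    r / (1 - r) * ((x ^ 2 + (1 - x) * r') / (1 - (x ^ 2 + (1 - x) * r')))
      ≤ r' / (1 - r') * ((x ^ 2 + (1 - x) * r) / (1 - (x ^ 2 + (1 - x) * r))) := by
  have h1r : 0 < 1 - r := by linarith
  have h1r' : 0 < 1 - r' := by linarith
  have h1l : 0 < 1 - (x ^ 2 + (1 - x) * r) := by nlinarith
  have h1l' : 0 < 1 - (x ^ 2 + (1 - x) * r') := by nlinarith
  rw [div_mul_div_comm, div_mul_div_comm, div_le_div_iff₀ (mul_pos h1r h1l') (mul_pos h1r' h1l)]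
  have key : r' * (x ^ 2 + (1 - x) * r) * ((1 - r) * (1 - (x ^ 2 + (1 - x) * r')))
      - r * (x ^ 2 + (1 - x) * r') * ((1 - r') * (1 - (x ^ 2 + (1 - x) * r)))
      = (1 - x) * ((r' - r) * x * (r * r' * (1 - x) + x * ((1 - r) * (1 - r')) + x ^ 2)) := by ring
  have hpos : 0 ≤ (1 - x) * ((r' - r) * x * (r * r' * (1 - x) + x * ((1 - r) * (1 - r')) + x ^ 2)) := by
    have : 0 ≤ r * r' * (1 - x) := mul_nonneg (mul_nonneg hr0 (by linarith)) (by linarith)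
    have : 0 ≤ x * ((1 - r) * (1 - r')) := mul_nonneg hx0.le (mul_nonneg h1r.le h1r'.le)
    have : 0 ≤ (r' - r) * x := mul_nonneg (by linarith) hx0.le
    have : 0 < 1 - x := by linarith
    positivity
  linarith

/-! ### The four closed-form Monge inequalities (real variables) -/

/-- **heavy Monge**: `u_H(l₂,h₁)·u_H(l₁,h₂) ≤ u_H(l₁,h₁)·u_H(l₂,h₂)` for `l₁ ≤ l₂`, `h₁ ≤ h₂`, `2l₂ < T < l₁ + h₁`
(`s₁₁s₂₂ ≤ s₁₂s₂₁`, `s = l + h − T`). [this work] -/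
theorem heavy_monge (T l₁ l₂ h₁ h₂ : ℝ) (hl : l₁ ≤ l₂) (hh : h₁ ≤ h₂) (hlow : 2 * l₂ < T) (hcomp : T < l₁ + h₁) :
    (T - 2 * l₂) / (l₂ + h₁ - T) * ((T - 2 * l₁) / (l₁ + h₂ - T))
      ≤ (T - 2 * l₁) / (l₁ + h₁ - T) * ((T - 2 * l₂) / (l₂ + h₂ - T)) := by
  have hp1 : 0 < T - 2 * l₁ := by linarith
  have hp2 : 0 < T - 2 * l₂ := by linarith
  have hs11 : 0 < l₁ + h₁ - T := by linarith
  have hs12 : 0 < l₁ + h₂ - T := by linarith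
  have hs21 : 0 < l₂ + h₁ - T := by linarith
  have hs22 : 0 < l₂ + h₂ - T := by linarith
  rw [div_mul_div_comm, div_mul_div_comm, div_le_div_iff₀ (mul_pos hs21 hs12) (mul_pos hs11 hs22)]
  have key : (T - 2 * l₁) * (T - 2 * l₂) * ((l₂ + h₁ - T) * (l₁ + h₂ - T))
      - (T - 2 * l₂) * (T - 2 * l₁) * ((l₁ + h₁ - T) * (l₂ + h₂ - T))
      = (T - 2 * l₁) * (T - 2 * l₂) * ((l₂ - l₁) * (h₂ - h₁)) := by ring
  have : 0 ≤ (T - 2 * l₁) * (T - 2 * l₂) * ((l₂ - l₁) * (h₂ - h₁)) :=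
    mul_nonneg (mul_pos hp1 hp2).le (mul_nonneg (by linarith) (by linarith))
  linarith

/-- **light Monge**: `u_L(l₂,h₁)·u_L(l₁,h₂) ≤ u_L(l₁,h₁)·u_L(l₂,h₂)` for `l₁ ≤ l₂`, `h₁ ≤ h₂`, `2l₂ < T < l₁ + h₁`, `0 < x < 1`
(numerator and inverse denominator are both log-supermodular affine functions of `(l, h)`). [this work] -/
theorem light_monge (x T l₁ l₂ h₁ h₂ : ℝ) (hx0 : 0 < x) (hx1 : x < 1) (hl : l₁ ≤ l₂) (hh : h₁ ≤ h₂) (hlow : 2 * l₂ < T)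
    (hcomp : T < l₁ + h₁) :
    (x ^ 2 * (h₁ - l₂) + (1 - x) * (T - 2 * l₂)) / ((1 - x) * ((1 - x) * l₂ + (1 + x) * h₁ - T))
        * ((x ^ 2 * (h₂ - l₁) + (1 - x) * (T - 2 * l₁)) / ((1 - x) * ((1 - x) * l₁ + (1 + x) * h₂ - T)))
      ≤ (x ^ 2 * (h₁ - l₁) + (1 - x) * (T - 2 * l₁)) / ((1 - x) * ((1 - x) * l₁ + (1 + x) * h₁ - T))
        * ((x ^ 2 * (h₂ - l₂) + (1 - x) * (T - 2 * l₂)) / ((1 - x) * ((1 - x) * l₂ + (1 + x) * h₂ - T))) := by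
  have h1x : 0 < 1 - x := by linarith
  -- positivity of the eight affine pieces
  have hN : ∀ l h : ℝ, 2 * l < T → T < l + h → 0 < x ^ 2 * (h - l) + (1 - x) * (T - 2 * l) := by
    intro l h h1 h2
    have : 0 < h - l := by linarith
    positivity
  have hE : ∀ l h : ℝ, 2 * l < T → T < l + h → 0 < (1 - x) * ((1 - x) * l + (1 + x) * h - T) := by
    intro l h h1 h2
    apply mul_pos h1x
    have : 0 < h - l := by linarith
    nlinarith
  have hN11 := hN l₁ h₁ (by linarith) hcomp
  have hN22 := hN l₂ h₂ hlow (by linarith)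
  have hE11 := hE l₁ h₁ (by linarith) hcomp
  have hE12 := hE l₁ h₂ (by linarith) (by linarith)
  have hE21 := hE l₂ h₁ hlow (by linarith)
  have hE22 := hE l₂ h₂ hlow (by linarith)
  rw [div_mul_div_comm, div_mul_div_comm, div_le_div_iff₀ (mul_pos hE21 hE12) (mul_pos hE11 hE22)]
  -- N-part: N₁₁N₂₂ − N₂₁N₁₂ = x²(x²−2x+2)(l₂−l₁)(h₂−h₁) =: P ≥ 0
  have kN : (x ^ 2 * (h₁ - l₁) + (1 - x) * (T - 2 * l₁)) * (x ^ 2 * (h₂ - l₂) + (1 - x) * (T - 2 * l₂))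
      - (x ^ 2 * (h₁ - l₂) + (1 - x) * (T - 2 * l₂)) * (x ^ 2 * (h₂ - l₁) + (1 - x) * (T - 2 * l₁))
      = x ^ 2 * (x ^ 2 - 2 * x + 2) * ((l₂ - l₁) * (h₂ - h₁)) := by ring
  -- E-part: E₂₁E₁₂ − E₁₁E₂₂ = (1−x)³(1+x)(l₂−l₁)(h₂−h₁) =: Q ≥ 0
  have kE : ((1 - x) * ((1 - x) * l₂ + (1 + x) * h₁ - T)) * ((1 - x) * ((1 - x) * l₁ + (1 + x) * h₂ - T))
      - ((1 - x) * ((1 - x) * l₁ + (1 + x) * h₁ - T)) * ((1 - x) * ((1 - x) * l₂ + (1 + x) * h₂ - T))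
      = (1 - x) ^ 3 * (1 + x) * ((l₂ - l₁) * (h₂ - h₁)) := by ring
  have hdd : 0 ≤ (l₂ - l₁) * (h₂ - h₁) := mul_nonneg (by linarith) (by linarith)
  have hq : 0 < x ^ 2 - 2 * x + 2 := by nlinarith
  have hP : 0 ≤ x ^ 2 * (x ^ 2 - 2 * x + 2) * ((l₂ - l₁) * (h₂ - h₁)) := by positivity
  have hQ : 0 ≤ (1 - x) ^ 3 * (1 + x) * ((l₂ - l₁) * (h₂ - h₁)) := by positivity
  -- abbreviate and conclude: N₂₁N₁₂·E₁₁E₂₂ = (N₁₁N₂₂ − P)·E₁₁E₂₂ ≤ N₁₁N₂₂·(E₁₁E₂₂ + Q) = N₁₁N₂₂·E₂₁E₁₂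
  set N11 := x ^ 2 * (h₁ - l₁) + (1 - x) * (T - 2 * l₁) with hN11def
  set N12 := x ^ 2 * (h₂ - l₁) + (1 - x) * (T - 2 * l₁) with hN12def
  set N21 := x ^ 2 * (h₁ - l₂) + (1 - x) * (T - 2 * l₂) with hN21def
  set N22 := x ^ 2 * (h₂ - l₂) + (1 - x) * (T - 2 * l₂) with hN22def
  set E11 := (1 - x) * ((1 - x) * l₁ + (1 + x) * h₁ - T) with hE11def
  set E12 := (1 - x) * ((1 - x) * l₁ + (1 + x) * h₂ - T) with hE12def
  set E21 := (1 - x) * ((1 - x) * l₂ + (1 + x) * h₁ - T) with hE21def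
  set E22 := (1 - x) * ((1 - x) * l₂ + (1 + x) * h₂ - T) with hE22def
  set P := x ^ 2 * (x ^ 2 - 2 * x + 2) * ((l₂ - l₁) * (h₂ - h₁)) with hPdef
  set Q := (1 - x) ^ 3 * (1 + x) * ((l₂ - l₁) * (h₂ - h₁)) with hQdef
  clear_value N11 N12 N21 N22 E11 E12 E21 E22 P Q
  have hNN : 0 ≤ N11 * N22 := (mul_pos hN11 hN22).le
  have hEE : 0 ≤ E11 * E22 := (mul_pos hE11 hE22).le
  have e1 : N21 * N12 = N11 * N22 - P := by linarith
  have e2 : E21 * E12 = E11 * E22 + Q := by linarith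
  rw [e1, e2]
  nlinarith [mul_nonneg hNN hQ, mul_nonneg hP hEE]

/-- **heavy × light cross Monge**: `u_H(l₂,h₁)·u_L(l₁,h₂) ≤ u_H(l₁,h₁)·u_L(l₂,h₂)` for `l₁ ≤ l₂`, `h₁ ≤ h₂`, `2l₂ < T < l₁ + h₁`,
`0 < x < 1` (so `2h₂ > T`): the heavy Monge inequality chained with `Φ(ρ₂₂) ≤ Φ(ρ₁₂)` (`ρ` is antitone in `l` at `h₂`). [this work] -/
theorem heavy_light_monge (x T l₁ l₂ h₁ h₂ : ℝ) (hx0 : 0 < x) (hx1 : x < 1) (hl : l₁ ≤ l₂) (hh : h₁ ≤ h₂)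
    (hlow : 2 * l₂ < T) (hcomp : T < l₁ + h₁) :
    (T - 2 * l₂) / (l₂ + h₁ - T)
        * ((x ^ 2 * (h₂ - l₁) + (1 - x) * (T - 2 * l₁)) / ((1 - x) * ((1 - x) * l₁ + (1 + x) * h₂ - T)))
      ≤ (T - 2 * l₁) / (l₁ + h₁ - T)
        * ((x ^ 2 * (h₂ - l₂) + (1 - x) * (T - 2 * l₂)) / ((1 - x) * ((1 - x) * l₂ + (1 + x) * h₂ - T))) := by
  have h1x : 0 < 1 - x := by linarith
  have hp1 : 0 < T - 2 * l₁ := by linarith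
  have hp2 : 0 < T - 2 * l₂ := by linarith
  have hs11 : 0 < l₁ + h₁ - T := by linarith
  have hs12 : 0 < l₁ + h₂ - T := by linarith
  have hs21 : 0 < l₂ + h₁ - T := by linarith
  have hs22 : 0 < l₂ + h₂ - T := by linarith
  have hd12 : 0 < h₂ - l₁ := by linarith
  have hd22 : 0 < h₂ - l₂ := by linarith
  have hN12 : 0 < x ^ 2 * (h₂ - l₁) + (1 - x) * (T - 2 * l₁) := by positivity
  have hE22 : 0 < (1 - x) * ((1 - x) * l₂ + (1 + x) * h₂ - T) := by
    apply mul_pos h1x; nlinarith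
  -- (1) heavy Monge: A₂₁·A₁₂ ≤ A₁₁·A₂₂
  have hHH := heavy_monge T l₁ l₂ h₁ h₂ hl hh hlow hcomp
  -- (2) Φ-monotonicity in the column h₂ (ρ₂₂ ≤ ρ₁₂ since 2h₂ > T, forced by T < l₁ + h₂ and 2l₁ < T): A₂₂·L₁₂ ≤ A₁₂·L₂₂
  have hρ : (T - 2 * l₂) / (h₂ - l₂) ≤ (T - 2 * l₁) / (h₂ - l₁) := by
    rw [div_le_div_iff₀ hd22 hd12]; nlinarith
  have hρ0 : 0 ≤ (T - 2 * l₂) / (h₂ - l₂) := (div_pos hp2 hd22).le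
  have hρ1 : (T - 2 * l₁) / (h₂ - l₁) < 1 := by rw [div_lt_one hd12]; linarith
  have hcross : (T - 2 * l₂) / (l₂ + h₂ - T)
        * ((x ^ 2 * (h₂ - l₁) + (1 - x) * (T - 2 * l₁)) / ((1 - x) * ((1 - x) * l₁ + (1 + x) * h₂ - T)))
      ≤ (T - 2 * l₁) / (l₁ + h₂ - T)
        * ((x ^ 2 * (h₂ - l₂) + (1 - x) * (T - 2 * l₂)) / ((1 - x) * ((1 - x) * l₂ + (1 + x) * h₂ - T))) := by
    rw [← heavy_of_rho T l₂ h₂ hd22, ← light_of_rho x T l₁ h₂ hd12, ← heavy_of_rho T l₁ h₂ hd12,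
      ← light_of_rho x T l₂ h₂ hd22]
    exact phi_mono x _ _ hx0 hx1 hρ0 hρ hρ1
  -- (3) multiply (1) and (2) and cancel A₁₂·A₂₂ > 0
  have hA12 : 0 < (T - 2 * l₁) / (l₁ + h₂ - T) := div_pos hp1 hs12
  have hA22 : 0 < (T - 2 * l₂) / (l₂ + h₂ - T) := div_pos hp2 hs22
  have hA11 : 0 ≤ (T - 2 * l₁) / (l₁ + h₁ - T) := (div_pos hp1 hs11).le
  have hL12 : 0 ≤ (x ^ 2 * (h₂ - l₁) + (1 - x) * (T - 2 * l₁)) / ((1 - x) * ((1 - x) * l₁ + (1 + x) * h₂ - T)) :=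
    (div_pos hN12 (by apply mul_pos h1x; nlinarith)).le
  have hprod := mul_le_mul hHH hcross (mul_nonneg hA22.le hL12) (mul_nonneg hA11 hA22.le)
  set A11 := (T - 2 * l₁) / (l₁ + h₁ - T)
  set A12 := (T - 2 * l₁) / (l₁ + h₂ - T)
  set A21 := (T - 2 * l₂) / (l₂ + h₁ - T)
  set A22 := (T - 2 * l₂) / (l₂ + h₂ - T)
  set L12 := (x ^ 2 * (h₂ - l₁) + (1 - x) * (T - 2 * l₁)) / ((1 - x) * ((1 - x) * l₁ + (1 + x) * h₂ - T))
  set L22 := (x ^ 2 * (h₂ - l₂) + (1 - x) * (T - 2 * l₂)) / ((1 - x) * ((1 - x) * l₂ + (1 + x) * h₂ - T))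
  -- hprod : (A21·A12)·(A22·L12) ≤ (A11·A22)·(A12·L22)
  have key : (A12 * A22) * (A21 * L12) ≤ (A12 * A22) * (A11 * L22) := by
    have e : A21 * A12 * (A22 * L12) = (A12 * A22) * (A21 * L12) := by ring
    have e' : A11 * A22 * (A12 * L22) = (A12 * A22) * (A11 * L22) := by ring
    rw [← e, ← e']; exact hprod
  exact le_of_mul_le_mul_left key (mul_pos hA12 hA22)

/-- **light × heavy cross Monge**: `u_L(l₂,h₁)·u_H(l₁,h₂) ≤ u_H(l₁,h₁)·u_L(l₂,h₂)` for `l₁ ≤ l₂`, `h₁ ≤ h₂`, `2l₂ < T < l₁ + h₁`,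
`0 < x < 1`: the heavy Monge inequality chained with `Φ(ρ₂₂) ≤ Φ(ρ₂₁)` (`ρ` is antitone in `h`). [this work] -/
theorem light_heavy_monge (x T l₁ l₂ h₁ h₂ : ℝ) (hx0 : 0 < x) (hx1 : x < 1) (hl : l₁ ≤ l₂) (hh : h₁ ≤ h₂)
    (hlow : 2 * l₂ < T) (hcomp : T < l₁ + h₁) :
    (x ^ 2 * (h₁ - l₂) + (1 - x) * (T - 2 * l₂)) / ((1 - x) * ((1 - x) * l₂ + (1 + x) * h₁ - T))
        * ((T - 2 * l₁) / (l₁ + h₂ - T))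
      ≤ (T - 2 * l₁) / (l₁ + h₁ - T)
        * ((x ^ 2 * (h₂ - l₂) + (1 - x) * (T - 2 * l₂)) / ((1 - x) * ((1 - x) * l₂ + (1 + x) * h₂ - T))) := by
  have h1x : 0 < 1 - x := by linarith
  have hp1 : 0 < T - 2 * l₁ := by linarith
  have hp2 : 0 < T - 2 * l₂ := by linarith
  have hs11 : 0 < l₁ + h₁ - T := by linarith
  have hs12 : 0 < l₁ + h₂ - T := by linarith
  have hs21 : 0 < l₂ + h₁ - T := by linarith
  have hs22 : 0 < l₂ + h₂ - T := by linarith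
  have hd21 : 0 < h₁ - l₂ := by linarith
  have hd22 : 0 < h₂ - l₂ := by linarith
  have hN21 : 0 < x ^ 2 * (h₁ - l₂) + (1 - x) * (T - 2 * l₂) := by positivity
  have hE21 : 0 < (1 - x) * ((1 - x) * l₂ + (1 + x) * h₁ - T) := by
    apply mul_pos h1x; nlinarith
  -- (1) heavy Monge: A₂₁·A₁₂ ≤ A₁₁·A₂₂
  have hHH := heavy_monge T l₁ l₂ h₁ h₂ hl hh hlow hcomp
  -- (2) Φ-monotonicity in the row l₂ (ρ₂₂ ≤ ρ₂₁): A₂₂·L₂₁ ≤ A₂₁·L₂₂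
  have hρ : (T - 2 * l₂) / (h₂ - l₂) ≤ (T - 2 * l₂) / (h₁ - l₂) :=
    div_le_div_of_nonneg_left hp2.le hd21 (by linarith)
  have hρ0 : 0 ≤ (T - 2 * l₂) / (h₂ - l₂) := (div_pos hp2 hd22).le
  have hρ1 : (T - 2 * l₂) / (h₁ - l₂) < 1 := by rw [div_lt_one hd21]; linarith
  have hcross : (T - 2 * l₂) / (l₂ + h₂ - T)
        * ((x ^ 2 * (h₁ - l₂) + (1 - x) * (T - 2 * l₂)) / ((1 - x) * ((1 - x) * l₂ + (1 + x) * h₁ - T)))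
      ≤ (T - 2 * l₂) / (l₂ + h₁ - T)
        * ((x ^ 2 * (h₂ - l₂) + (1 - x) * (T - 2 * l₂)) / ((1 - x) * ((1 - x) * l₂ + (1 + x) * h₂ - T))) := by
    rw [← heavy_of_rho T l₂ h₂ hd22, ← light_of_rho x T l₂ h₁ hd21, ← heavy_of_rho T l₂ h₁ hd21,
      ← light_of_rho x T l₂ h₂ hd22]
    exact phi_mono x _ _ hx0 hx1 hρ0 hρ hρ1
  -- (3) multiply and cancel A₂₁·A₂₂ > 0
  have hA21 : 0 < (T - 2 * l₂) / (l₂ + h₁ - T) := div_pos hp2 hs21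
  have hA22 : 0 < (T - 2 * l₂) / (l₂ + h₂ - T) := div_pos hp2 hs22
  have hA11 : 0 ≤ (T - 2 * l₁) / (l₁ + h₁ - T) := (div_pos hp1 hs11).le
  have hL21 : 0 ≤ (x ^ 2 * (h₁ - l₂) + (1 - x) * (T - 2 * l₂)) / ((1 - x) * ((1 - x) * l₂ + (1 + x) * h₁ - T)) :=
    (div_pos hN21 hE21).le
  have hprod := mul_le_mul hHH hcross (mul_nonneg hA22.le hL21) (mul_nonneg hA11 hA22.le)
  set A11 := (T - 2 * l₁) / (l₁ + h₁ - T)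
  set A12 := (T - 2 * l₁) / (l₁ + h₂ - T)
  set A21 := (T - 2 * l₂) / (l₂ + h₁ - T)
  set A22 := (T - 2 * l₂) / (l₂ + h₂ - T)
  set L21 := (x ^ 2 * (h₁ - l₂) + (1 - x) * (T - 2 * l₂)) / ((1 - x) * ((1 - x) * l₂ + (1 + x) * h₁ - T))
  set L22 := (x ^ 2 * (h₂ - l₂) + (1 - x) * (T - 2 * l₂)) / ((1 - x) * ((1 - x) * l₂ + (1 + x) * h₂ - T))
  -- hprod : (A21·A12)·(A22·L21) ≤ (A11·A22)·(A21·L22)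
  have key : (A21 * A22) * (L21 * A12) ≤ (A21 * A22) * (A11 * L22) := by
    have e : A21 * A12 * (A22 * L21) = (A21 * A22) * (L21 * A12) := by ring
    have e' : A11 * A22 * (A21 * L22) = (A21 * A22) * (A11 * L22) := by ring
    rw [← e, ← e']; exact hprod
  exact le_of_mul_le_mul_left key (mul_pos hA21 hA22)

end LawDec

end Quant

end Summit.CriticalPhenomena.PercolationContinuityZ3.Theorems
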